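import Literature.AlgebraicGeometry.Motives.HodgeStructurePolarizationAdjointPoints
import Literature.AlgebraicGeometry.Motives.HodgeStructureCentralizerEquivariantForms
import HarnessLib

/-!
# Proposition 1.3 over a field `K ⊇ ℚ`, as printed: the `C(A)`-equivariant `ε`-symmetric `K`-bilinear forms are "exactly the
# `k`-linear combinations of forms `e_D` with `D` a divisor on `A`" — the solution space over `K` is the base change of the
# rational one; "`β = Σ cᵢβᵢ` with `cᵢ ∈ k`, `βᵢ ∈ End⁰(A)`, `βᵢ† = βᵢ`" (Milne 1999 §1 Prop. 1.3 and its proof, p. 643 L34–L51)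

[topic AlgebraicGeometry/Motives]

Layer `Literature/AlgebraicGeometry/Motives`, lane `lit-hodgefound` (Track 2 foundations library; seat `lit-hodgefound-p34`,
generation 20, FILE 2 of the self-proposed row g20-#5 of `run/shared/lean/pub/lit-hodgefound/SKELETON.md`). THEOREMS ONLY;
no definition, no named fact (net debt `0`). It closes Proposition 1.3 on `K`-points: the seat's g18-#2
`Motives/HodgeStructureCentralizerEquivariantForms` proves Prop. 1.3 over `ℚ` with its parity clause
(`Polarization.forall_centralizer_form_apply_adjoint_and_swap_iff`: a rational form is `†`-equivariant under `C(H)` and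
`ε`-symmetric iff it is `Q(s ·, ·)` with `s ∈ E_φ`, `s† = s` — the abstract-Hodge-structure reading of "the forms `e_D`, `D` a
divisor", `NS(A)_ℚ ≅ {s ∈ End⁰(A) | s† = s}` by Mumford p. 208), g18-#8 `Motives/HodgeStructureCentralizerEquivariantFormsPoints`
proves (1.2) over `K` (`β ∈ E_φ ⊗ K`), and FILE 1 of g20-#5 `Motives/HodgeStructurePolarizationAdjointPoints` adds Milne's
involution `†` on `End_K(K ⊗ V)` and the parity clause over `K` (`β† = β`). Here: the LAST SENTENCE of the printed proof on
`K`-points — "Hence `β = Σ cᵢβᵢ` with `cᵢ ∈ k`, `βᵢ ∈ End⁰(A)`, [`βᵢ† = βᵢ`]" — and the printed conclusion "exactly the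
`k`-linear combinations of forms `e_D`".

## The source, verbatim

J. S. Milne, *Lefschetz classes on abelian varieties*, Duke Math. J. **96** (1999) 639–675 [Milne1999LefschetzClasses]
(held `paper:doi-10-1215-s0012-7094-99-09620-5`; Duke page = folio + 638), §1 p. 643 (p0005) L34–L51: "**Proposition 1.3.**
The skew-symmetric `k`-bilinear forms `ψ : V(A) × V(A) → k(1)` such that `ψ ∘ (γ × 1) = ψ ∘ (1 × γ†)`, all `γ ∈ C(A)`, are
exactly the `k`-linear combinations of forms `e_D` with `D` a divisor on `A`. *Proof.* Let `D₀` be an ample divisor on `A`,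
and let `†` be the involution it defines on `End_k(V(A))`. […] any `k`-bilinear form `ψ` […] can be written
`ψ = e_{D₀} ∘ (β × 1)` for some `β ∈ End_k(V(A))`. If `ψ` is skew-symmetric, then `β = β†`, and (1.2)
`ψ ∘ (γ × 1) = ψ ∘ (1 × γ†), ∀γ ∈ C(A) ⟹ βγ = γβ, ∀γ ∈ C(A) ⟹ β ∈ End⁰(A) ⊗_ℚ k`. Therefore, any `ψ` as in the statement
of the proposition is of the form `e_{D₀} ∘ (β × 1)` for some `β ∈ End⁰(A) ⊗_ℚ k` with `β = β†`. **Hence `β = Σ cᵢβᵢ` with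
`cᵢ ∈ k`, `βᵢ ∈ End⁰(A)`,** `βᵢ† = βᵢ`. According to (Mumford 1970, p208), `e_{D₀} ∘ (βᵢ × 1)` is of the form `e_{Dᵢ}` for a
divisor `Dᵢ` on `A`, which completes the proof." (p0006 L5–L6.)

CARRIER. `H : HodgeStructure V n`, `Q : Polarization H` (any weight, parity `ε = (-1)ⁿ`: "skew-symmetric" is "`ε`-symmetric"),
a field `K ⊇ ℚ` (Milne's `k`), `V(A) ⊗ = K ⊗_ℚ V`, `e_{D₀} = Q_K = Q.form.baseChange K`, `E_φ = End_HS(H) = H.endAlg`,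
`C(H) = Subalgebra.centralizer ℚ E_φ`, `†` on `End_ℚ(V)` = `Polarization.adjoint`, `†` on `End_K(K ⊗ V)` =
`Polarization.adjointBaseChange K` (g20-#5 FILE 1); "`E_φ ⊗ K`" = `span_K {a_K : a ∈ E_φ}`; "the forms `e_D`" =
`{Q(s ·, ·) : s ∈ E_φ, s† = s}` (g18-#2) and their base changes `(Q(s ·, ·))_K = Q_K(s_K ·, ·)`.

## What is PROVED (namespace `Literature.AlgebraicGeometry.Motives.HodgeStructure`)

* §1 **"Hence `β = Σ cᵢβᵢ` with `βᵢ† = βᵢ`"**: `Polarization.add_adjointBaseChange_mem_span_of_mem_span_baseChange_endAlg`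
  (`β ∈ E_φ ⊗ K ⟹ β + β† ∈ span_K {s_K : s ∈ E_φ, s† = s}`, by `K`-linearity of `†` and `(a_K)† = (a†)_K`) and
  **`Polarization.mem_span_and_adjointBaseChange_eq_self_iff_mem_span_symmetric`**: `β ∈ E_φ ⊗ K ∧ β† = β ⟺
  β ∈ span_K {s_K : s ∈ E_φ, s† = s}` (`β = ½(β + β†)`, `char K = 0`) — the `†`-symmetric part of `E_φ ⊗ K` is the base
  change of the rational `†`-symmetric part ("`NS(A)_ℚ ⊗ k`").
* §2 `Polarization.baseChange_form_comp_apply` / `baseChange_form_comp` (`(Q ∘ a)_K = Q_K ∘ a_K`),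
  `Polarization.mem_span_baseChange_form_comp_iff` (`B ∈ span_K {(Q(s·,·))_K} ⟺ B = Q_K(β ·, ·)` with `β` in the span of
  §1; the map `β ↦ Q_K(β ·, ·)` is `K`-linear, Mathlib's `LinearMap.llcomp`), and the two forms of the printed statement:
  **`Polarization.forall_centralizer_baseChange_form_apply_adjoint_and_swap_iff_mem_span`** — a `K`-bilinear form `B` on
  `K ⊗ V` is `†`-equivariant under `C(H)` and `ε`-symmetric **iff** `B ∈ span_K {(Q(s ·, ·))_K : s ∈ E_φ, s† = s}` — and
  **`Polarization.forall_centralizer_baseChange_form_apply_adjoint_and_swap_iff_mem_span_baseChange`** — **iff** `B` is a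
  `K`-linear combination of base changes `B₀ ⊗ K` of RATIONAL forms `B₀` solving Proposition 1.3 over `ℚ` (the two generating
  sets agree: `Polarization.image_baseChange_form_comp_symmetric_eq`, by g18-#2).

NOT HERE: "`e_{D₀} ∘ (βᵢ × 1)` is of the form `e_{Dᵢ}` for a divisor `Dᵢ`" (Mumford p. 208 — abelian varieties; on the
abstract Hodge structure the symmetric `s ∈ E_φ` ARE the avatars of `NS(A)_ℚ`, g18-#2 §5 reads `Q(s ·, ·)` as a morphism
`H ⊗ H → ℚ(-n)`); the ample ones among them (the seat's g19-#2 `Motives/HodgeStructurePolarizationCone`).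

## References

* [Milne1999LefschetzClasses] J. S. Milne, *Lefschetz classes on abelian varieties*, Duke Math. J. 96 (1999) 639–675, §1
  Prop. 1.3 and its proof (p. 643 L34–L51, p. 644 L5–L6), Remark 1.6 (p. 644).
* [MumfordAV1970] D. Mumford, *Abelian varieties* (1970), §20–§21, Application III p. 208 (`NS(A) ⊗ ℚ ≅` symmetric
  elements of `End⁰(A)` for the Rosati involution).
-/

noncomputable section

open scoped TensorProduct

universe uK u

namespace Literature.AlgebraicGeometry.Motives

namespace HodgeStructure

/-! ### §1 The `†`-symmetric part of `E_φ ⊗ K` is spanned by the rational `†`-symmetric endomorphisms ("`NS(A)_ℚ ⊗ k`") -/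

section SymmetricPart

variable (K : Type uK) [Field K] [Algebra ℚ K] {V : Type u} [AddCommGroup V] [Module ℚ V] [Module.Finite ℚ V] {n : ℤ}
  {H : HodgeStructure V n} (Q : Polarization H)

/-- For `β ∈ E_φ ⊗ K` (the `K`-span of the `a_K`, `a ∈ E_φ`), the symmetrisation `β + β†` is a `K`-linear combination of base
changes of RATIONAL `†`-symmetric Hodge endomorphisms `s = a + a† ∈ E_φ`, `s† = s` (`†` is `K`-linear and `(a_K)† = (a†)_K`).
[cite: Milne1999LefschetzClasses, §1 proof of Prop. 1.3 (p. 643 L46–L51: "β = Σ cᵢβᵢ with cᵢ ∈ k, βᵢ ∈ End⁰(A), βᵢ† = βᵢ")] -/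
theorem Polarization.add_adjointBaseChange_mem_span_of_mem_span_baseChange_endAlg {β : Module.End K (K ⊗[ℚ] V)}
    (hβ : β ∈ Submodule.span K (Set.range fun a : H.endAlg ↦ (a : Module.End ℚ V).baseChange K)) :
    β + Q.adjointBaseChange K β ∈ Submodule.span K ((fun a : Module.End ℚ V ↦ a.baseChange K) ''
      {a | a ∈ H.endAlg ∧ Q.adjoint a = a}) := by
  induction hβ using Submodule.span_induction with
  | mem x hx =>
    obtain ⟨a, rfl⟩ := hx
    rw [Q.adjointBaseChange_baseChange K, ← LinearMap.baseChange_add]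
    refine Submodule.subset_span ⟨(a : Module.End ℚ V) + Q.adjoint a, ⟨?_, ?_⟩, rfl⟩
    · exact H.endAlg.add_mem a.2 (Q.adjoint_mem_endAlg a.2)
    · rw [Q.adjoint_add, Q.adjoint_adjoint, add_comm]
  | zero => rw [Q.adjointBaseChange_zero K, add_zero]; exact Submodule.zero_mem _
  | add x y _ _ hx hy =>
    rw [Q.adjointBaseChange_add K, add_add_add_comm]
    exact Submodule.add_mem _ hx hy
  | smul c x _ hx =>
    rw [Q.adjointBaseChange_smul K, ← smul_add]
    exact Submodule.smul_mem _ c hx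

/-- **The `†`-symmetric elements of `E_φ ⊗ K` are exactly the `K`-linear combinations of base changes of rational
`†`-symmetric Hodge endomorphisms**: `β ∈ E_φ ⊗ K` with `β† = β` iff `β ∈ span_K {s_K : s ∈ E_φ, s† = s}` — Milne's
"Hence `β = Σ cᵢβᵢ` with `cᵢ ∈ k`, `βᵢ ∈ End⁰(A)`, [`βᵢ† = βᵢ`]" (the symmetric elements of `End⁰(A)` being `NS(A)_ℚ` under
`D ↦ e_{D₀}⁻¹ e_D`, Mumford p. 208). [cite: Milne1999LefschetzClasses, §1 proof of Prop. 1.3 (p. 643 L46–L51)]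
[cite: MumfordAV1970, §20–§21 Application III p. 208] -/
theorem Polarization.mem_span_and_adjointBaseChange_eq_self_iff_mem_span_symmetric (β : Module.End K (K ⊗[ℚ] V)) :
    (β ∈ Submodule.span K (Set.range fun a : H.endAlg ↦ (a : Module.End ℚ V).baseChange K) ∧ Q.adjointBaseChange K β = β) ↔
      β ∈ Submodule.span K ((fun a : Module.End ℚ V ↦ a.baseChange K) '' {a | a ∈ H.endAlg ∧ Q.adjoint a = a}) := by
  haveI : CharZero K := algebraRat.charZero K
  constructor
  · rintro ⟨hβ, hadj⟩
    have h2 : β = (2 : K)⁻¹ • (β + Q.adjointBaseChange K β) := by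
      rw [hadj, ← two_smul K β, smul_smul, inv_mul_cancel₀ (two_ne_zero' K), one_smul]
    rw [h2]
    exact Submodule.smul_mem _ _ (Q.add_adjointBaseChange_mem_span_of_mem_span_baseChange_endAlg K hβ)
  · intro hβ
    induction hβ using Submodule.span_induction with
    | mem x hx =>
      obtain ⟨a, ⟨ha, hadj⟩, rfl⟩ := hx
      exact ⟨Submodule.subset_span ⟨⟨a, ha⟩, rfl⟩, by rw [Q.adjointBaseChange_baseChange K, hadj]⟩
    | zero => exact ⟨Submodule.zero_mem _, Q.adjointBaseChange_zero K⟩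
    | add x y _ _ hx hy =>
      exact ⟨Submodule.add_mem _ hx.1 hy.1, by rw [Q.adjointBaseChange_add K, hx.2, hy.2]⟩
    | smul c x _ hx => exact ⟨Submodule.smul_mem _ c hx.1, by rw [Q.adjointBaseChange_smul K, hx.2]⟩

end SymmetricPart

/-! ### §2 "exactly the `k`-linear combinations of forms `e_D` with `D` a divisor on `A`", over `K` -/

section Forms

variable (K : Type uK) [Field K] [Algebra ℚ K] {V : Type u} [AddCommGroup V] [Module ℚ V] [Module.Finite ℚ V] {n : ℤ}
  {H : HodgeStructure V n} (Q : Polarization H)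

omit [Module.Finite ℚ V] in
/-- **Base change of a twisted form**: `(Q(a ·, ·))_K = Q_K(a_K ·, ·)`, i.e. `(Q ∘ a)_K (x, y) = Q_K (a_K x, y)`.
[cite: Milne1999LefschetzClasses, §1 p. 642 L73 ("e_{D′} = e_D ∘ (α × 1)") and Remark 1.6 (p. 644)] -/
theorem Polarization.baseChange_form_comp_apply (a : Module.End ℚ V) (x y : K ⊗[ℚ] V) :
    LinearMap.BilinForm.baseChange K (Q.form ∘ₗ a) x y = Q.form.baseChange K (a.baseChange K x) y := by
  induction x using TensorProduct.induction_on with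
  | zero => simp only [map_zero, LinearMap.zero_apply]
  | add x x' hx hx' => simp only [map_add, LinearMap.add_apply, hx, hx']
  | tmul c v =>
    induction y using TensorProduct.induction_on with
    | zero => simp only [map_zero]
    | add y y' hy hy' => simp only [map_add, hy, hy']
    | tmul d w => simp only [LinearMap.BilinForm.baseChange_tmul, LinearMap.baseChange_tmul, LinearMap.comp_apply]

omit [Module.Finite ℚ V] in
/-- The same as an identity of `K`-bilinear forms: `(Q ∘ a)_K = Q_K ∘ a_K`.
[cite: Milne1999LefschetzClasses, §1 p. 642 L73 and Remark 1.6] -/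
theorem Polarization.baseChange_form_comp (a : Module.End ℚ V) :
    LinearMap.BilinForm.baseChange K (Q.form ∘ₗ a) = Q.form.baseChange K ∘ₗ a.baseChange K :=
  LinearMap.ext fun x ↦ LinearMap.ext fun y ↦ by rw [Q.baseChange_form_comp_apply K, LinearMap.comp_apply]

/-- **Milne's "forms `e_D` with `D` a divisor", base-changed to `K`, are `K`-linearly spanned exactly as the twists
`Q_K(β ·, ·)` with `β` in the symmetric part of `E_φ ⊗ K`**: `B ∈ span_K {(Q(s ·, ·))_K : s ∈ E_φ, s† = s}` iff
`B = Q_K(β ·, ·)` for some `β ∈ span_K {s_K : s ∈ E_φ, s† = s}` (the map `β ↦ Q_K(β ·, ·)` is `K`-linear).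
[cite: Milne1999LefschetzClasses, §1 Prop. 1.3 and its proof (p. 643 L46–L51)] -/
theorem Polarization.mem_span_baseChange_form_comp_iff (B : LinearMap.BilinForm K (K ⊗[ℚ] V)) :
    B ∈ Submodule.span K ((fun a : Module.End ℚ V ↦ LinearMap.BilinForm.baseChange K (Q.form ∘ₗ a)) ''
        {a | a ∈ H.endAlg ∧ Q.adjoint a = a}) ↔
      ∃ β ∈ Submodule.span K ((fun a : Module.End ℚ V ↦ a.baseChange K) '' {a | a ∈ H.endAlg ∧ Q.adjoint a = a}),
        ∀ x y, B x y = Q.form.baseChange K (β x) y := by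
  -- the `K`-linear map `β ↦ Q_K ∘ β = Q_K(β ·, ·)`
  set Φ : Module.End K (K ⊗[ℚ] V) →ₗ[K] LinearMap.BilinForm K (K ⊗[ℚ] V) :=
    LinearMap.llcomp K (K ⊗[ℚ] V) (K ⊗[ℚ] V) ((K ⊗[ℚ] V) →ₗ[K] K) (Q.form.baseChange K) with hΦ
  have hΦa : ∀ a : Module.End ℚ V, LinearMap.BilinForm.baseChange K (Q.form ∘ₗ a) = Φ (a.baseChange K) := fun a ↦ by
    rw [hΦ, LinearMap.llcomp_apply', Q.baseChange_form_comp K]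
  have himage : (fun a : Module.End ℚ V ↦ LinearMap.BilinForm.baseChange K (Q.form ∘ₗ a)) ''
      {a | a ∈ H.endAlg ∧ Q.adjoint a = a} =
        Φ '' ((fun a : Module.End ℚ V ↦ a.baseChange K) '' {a | a ∈ H.endAlg ∧ Q.adjoint a = a}) := by
    rw [Set.image_image]
    exact Set.image_congr fun a _ ↦ hΦa a
  rw [himage, Submodule.span_image, Submodule.mem_map]
  refine exists_congr fun β ↦ and_congr Iff.rfl ⟨fun h x y ↦ ?_, fun h ↦ LinearMap.ext fun x ↦ LinearMap.ext fun y ↦ ?_⟩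
  · rw [← h, hΦ, LinearMap.llcomp_apply]
  · rw [hΦ, LinearMap.llcomp_apply, h x y]

variable [HodgeTensorFacts.{u, u}]

/-- **Proposition 1.3 over a field `K ⊇ ℚ`, as printed: "The skew-symmetric `k`-bilinear forms `ψ : V(A) × V(A) → k(1)` such
that `ψ ∘ (γ × 1) = ψ ∘ (1 × γ†)`, all `γ ∈ C(A)`, are exactly the `k`-linear combinations of forms `e_D` with `D` a divisor on
`A`"** — on the abstract polarized `ℚ`-Hodge structure, any weight (parity `ε = (-1)ⁿ`), with "the forms `e_D`" read as the
rational `C(H)`-equivariant `ε`-symmetric forms `Q(s ·, ·)`, `s ∈ E_φ`, `s† = s` (g18-#2 `Motives/HodgeStructureCentralizerEquivariantForms`,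
`forall_centralizer_form_apply_adjoint_and_swap_iff`; `NS(A)_ℚ ≅ {s ∈ End⁰(A) | s† = s}`, Mumford p. 208): a `K`-bilinear
form `B` on `K ⊗ V` is `†`-equivariant under `C(H)` and `ε`-symmetric iff `B` is a `K`-linear combination of the base changes
`(Q(s ·, ·))_K`. Mechanism as printed: `B = Q_K(β ·, ·)` with `β ∈ E_φ ⊗ K`, `β† = β` (g20-#5
`forall_centralizer_baseChange_form_apply_adjoint_and_swap_iff`), and `β = Σ cᵢ (sᵢ)_K` with `sᵢ` rational `†`-symmetric (§1).
[cite: Milne1999LefschetzClasses, §1 Prop. 1.3 and its proof (p. 643 L34–L51) and Remark 1.6 (p. 644)] [cite: MumfordAV1970, §20–§21 Application III p. 208] -/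
theorem Polarization.forall_centralizer_baseChange_form_apply_adjoint_and_swap_iff_mem_span (B : LinearMap.BilinForm K (K ⊗[ℚ] V)) :
    ((∀ c ∈ Subalgebra.centralizer ℚ (H.endAlg : Set (Module.End ℚ V)), ∀ x y,
        B (c.baseChange K x) y = B x ((Q.adjoint c).baseChange K y)) ∧
        ∀ x y, B y x = (((n.negOnePow : ℤˣ) : ℤ) : K) * B x y) ↔
      B ∈ Submodule.span K ((fun a : Module.End ℚ V ↦ LinearMap.BilinForm.baseChange K (Q.form ∘ₗ a)) ''
        {a | a ∈ H.endAlg ∧ Q.adjoint a = a}) := by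
  rw [Q.forall_centralizer_baseChange_form_apply_adjoint_and_swap_iff K B, Q.mem_span_baseChange_form_comp_iff K B]
  constructor
  · rintro ⟨β, hβ, hadj, hB⟩
    exact ⟨β, (Q.mem_span_and_adjointBaseChange_eq_self_iff_mem_span_symmetric K β).1 ⟨hβ, hadj⟩, hB⟩
  · rintro ⟨β, hβ, hB⟩
    obtain ⟨hβ', hadj⟩ := (Q.mem_span_and_adjointBaseChange_eq_self_iff_mem_span_symmetric K β).2 hβ
    exact ⟨β, hβ', hadj, hB⟩

/-- The set of "forms `e_D`" in the two descriptions agree: the base changes of the rational twists `Q(s ·, ·)`, `s ∈ E_φ`,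
`s† = s`, are exactly the base changes of the rational `C(H)`-equivariant `ε`-symmetric bilinear forms on `V` (g18-#2's
Proposition 1.3 over `ℚ`). [cite: Milne1999LefschetzClasses, §1 Prop. 1.3 (p. 643)] -/
theorem Polarization.image_baseChange_form_comp_symmetric_eq :
    (fun a : Module.End ℚ V ↦ LinearMap.BilinForm.baseChange K (Q.form ∘ₗ a)) '' {a | a ∈ H.endAlg ∧ Q.adjoint a = a} =
      (fun B₀ : LinearMap.BilinForm ℚ V ↦ B₀.baseChange K) ''
        {B₀ | (∀ c ∈ Subalgebra.centralizer ℚ (H.endAlg : Set (Module.End ℚ V)), ∀ v w, B₀ (c v) w = B₀ v (Q.adjoint c w)) ∧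
          ∀ v w, B₀ w v = (((n.negOnePow : ℤˣ) : ℤ) : ℚ) * B₀ v w} := by
  ext B
  constructor
  · rintro ⟨a, ⟨ha, hadj⟩, rfl⟩
    refine ⟨Q.form ∘ₗ a, ?_, rfl⟩
    exact (Q.forall_centralizer_form_apply_adjoint_and_swap_iff (Q.form ∘ₗ a)).2 ⟨a, ha, hadj, fun v w ↦ rfl⟩
  · rintro ⟨B₀, hB₀, rfl⟩
    obtain ⟨a, ha, hadj, h⟩ := (Q.forall_centralizer_form_apply_adjoint_and_swap_iff B₀).1 hB₀
    refine ⟨a, ⟨ha, hadj⟩, ?_⟩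
    have hB : B₀ = Q.form ∘ₗ a := LinearMap.ext fun v ↦ LinearMap.ext fun w ↦ by rw [h v w, LinearMap.comp_apply]
    rw [hB]

/-- **Proposition 1.3 over `K`, with "the forms `e_D`" read as the rational solutions of Proposition 1.3 over `ℚ`**: a
`K`-bilinear form on `K ⊗ V` is `†`-equivariant under `C(H)` and `ε`-symmetric iff it is a `K`-linear combination of base
changes `B₀ ⊗ K` of RATIONAL bilinear forms `B₀` on `V` that are `†`-equivariant under `C(H)` and `ε`-symmetric ("exactly the
`k`-linear combinations of forms `e_D`": the solution space over `k` is the base change of the solution space over `ℚ`).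
[cite: Milne1999LefschetzClasses, §1 Prop. 1.3 (p. 643) and Remark 1.6 (p. 644)] -/
theorem Polarization.forall_centralizer_baseChange_form_apply_adjoint_and_swap_iff_mem_span_baseChange
    (B : LinearMap.BilinForm K (K ⊗[ℚ] V)) :
    ((∀ c ∈ Subalgebra.centralizer ℚ (H.endAlg : Set (Module.End ℚ V)), ∀ x y,
        B (c.baseChange K x) y = B x ((Q.adjoint c).baseChange K y)) ∧
        ∀ x y, B y x = (((n.negOnePow : ℤˣ) : ℤ) : K) * B x y) ↔
      B ∈ Submodule.span K ((fun B₀ : LinearMap.BilinForm ℚ V ↦ B₀.baseChange K) ''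
        {B₀ | (∀ c ∈ Subalgebra.centralizer ℚ (H.endAlg : Set (Module.End ℚ V)), ∀ v w, B₀ (c v) w = B₀ v (Q.adjoint c w)) ∧
          ∀ v w, B₀ w v = (((n.negOnePow : ℤˣ) : ℤ) : ℚ) * B₀ v w}) := by
  rw [Q.forall_centralizer_baseChange_form_apply_adjoint_and_swap_iff_mem_span K B, Q.image_baseChange_form_comp_symmetric_eq K]

end Forms

end HodgeStructure

end Literature.AlgebraicGeometry.Motives

end
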